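import Literature.MathematicalPhysics.QuantumLattice.PairOperatorTriangleBounds
import Literature.MathematicalPhysics.QuantumLattice.FreeFermionSectorDeviationExact
import Literature.MathematicalPhysics.QuantumLattice.TorusInverseGapSum
import HarnessLib

/-!
# `d`-wave pair LRO costs kinetic energy at the rate `a^{3/2}` (free Fermi gas, uniform filling)

Family `hubbard` / topic `MathematicalPhysics/QuantumLattice`; third stage of
`FreeFermiGasPairingCost.lean` (rate `a⁶`) and `FreeFermiGasPairingCostSharp.lean` (rate `a²`, the
optimal power of the pair-Gram method). Replacing the pair Gram bound by the TRIANGLE bounds of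
`PairOperatorTriangleBounds.lean` (`√(a/8) L² ≤ 2 Σ_k √dev_k + 2 √(Σ_F x_k)`, `dev_k = x_k` above
and `1 - x_k` below a Fermi set `F`) and the smearing form of the bathtub bound by its EXACT
deviation form of `FreeFermionSectorDeviationExact.lean`
(`Σ_k |ε_k - ε_F| dev_k ≤ Re⟨ψ, H₀ψ⟩ - minEnergyOn`), one Cauchy–Schwarz with the weights
`1/|ε_k - ε_F|` outside the window `|ε_k - ε_F| < e₀` (`TorusInverseGapSum.lean`:
`Σ_{|ξ| ≥ e₀} 1/|ξ| ≤ 4L²/√e₀ + 4L/e₀`) gives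

* `freeDWavePairing_costs_energy_opt_explicit`: for `a > 0`, `L ≥ 3` with `a·L² ≥ 4608` and a
  unit `ψ ∈ szSector (2n) 0` with `Re ⟨ψ, Δ_d†Δ_d ψ⟩ ≥ a·L⁴`:
  `minEnergyOn H₀ (szSector (2n) 0) + (a√a/32768)·L² ≤ Re ⟨ψ, H₀ ψ⟩`, `H₀ = hubbardTorus 2 L 1 0`;
  `freeDWavePairing_costs_energy_opt_rate`: the same for every `N`, `L ≥ ⌈1536/a⌉ + 3`;
  `re_expect_pairField_dWave_lt_of_energy_excess_lt_opt`: the a-priori form.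

The rate `η(a) = a^{3/2}/32768` improves the quadratic one for `a < 1/16` and is optimal given only
the uniform `√η` density-of-states bound (a BCS trial profile saturates it); with the linear density
of states away from the van Hove level the same argument gives the Bardeen–Cooper–Schrieffer rate
`a / log(1/a)` (not done here). Consumers: `HubbardPairDensityCouplingFloorOptimal.lean` (ground-state
`d`-wave pair density of the repulsive Hubbard torus is `O(U^{2/3})`).

Sources: J. Bardeen, L. N. Cooper, J. R. Schrieffer, Phys. Rev. 108 (1957) 1175, §II (pair
amplitude versus kinetic cost of smearing the Fermi surface); E. H. Lieb, M. Loss, Analysis (2001),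
Thm 1.14 (bathtub); C. N. Yang, Rev. Mod. Phys. 34 (1962) 694, §3. Folklore finite-dimensional
statements; no named facts, no definitions.

## Mathlib / tree search

Tree: `sqrt_le_deviation_of_le_re_expect_pairField_dWave`, `exists_fermiSet_deviation_le_energy_excess`,
`sum_inv_abs_sub_le`, `card_torusShell_le_sqrt`, `card_torusSite`,
`exists_eq_two_mul_of_mem_szSector_zero`, `freeDWavePairing_costs_energy_sharp_rate` (rate `a²`).
Mathlib: `Real.sum_sqrt_mul_sqrt_le`, `Finset.sum_filter_add_sum_filter_not`,
`le_of_pow_le_pow_left₀`, `Real.sqrt_le_sqrt`.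
-/

noncomputable section

namespace Literature.MathematicalPhysics.QuantumLattice

open Matrix Finset Literature.Probability.LatticeModels
open scoped ComplexOrder ComplexConjugate

/-! ### Assembly: the `a^{3/2}` pairing-cost rate -/

section Assembly

variable {L : ℕ} [NeZero L]

/-- **`d`-wave pair LRO costs kinetic energy — rate `a^{3/2}`, explicit constants.** For `a > 0`,
`L ≥ 3` with `a·L² ≥ 4608`, and a unit vector `ψ ∈ szSector (2n) 0` with `Re ⟨ψ, Δ_d†Δ_d ψ⟩ ≥ a·L⁴`:
`minEnergyOn H₀ (szSector (2n) 0) + (a√a/32768)·L² ≤ Re ⟨ψ, H₀ ψ⟩`, `H₀ = hubbardTorus 2 L 1 0`.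
Proof: with `α = √(a/8)`, a Fermi set `F` of the deviation bound and `dev_k` its deviations,
`αL² ≤ 2Σ_k √dev_k + 2L` (triangle bounds); split at `|ε_k - ε_F| < e₀ = α²/16`: the window holds at
most `αL²/4 + 2L` momenta, and outside Cauchy–Schwarz gives `Σ √dev ≤ √(Σ|ξ|dev) · √(Σ 1/|ξ|) ≤ √K ·
√((16/α + 64/(α²L)) L²)`; for `αL ≥ 24` this forces `α³ L² ≤ (3584/3) K`.
Bardeen–Cooper–Schrieffer (1957) §II. [folklore] -/
theorem freeDWavePairing_costs_energy_opt_explicit {a : ℝ} (ha : 0 < a) (hL : 3 ≤ L)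
    (hLa : 4608 ≤ a * (L : ℝ) ^ 2) {n : ℕ} {ψ : Fock (Orb (FermionTorus 2 L))}
    (hψ : ψ ∈ szSector (Λ := FermionTorus 2 L) (2 * n) 0) (h1 : star ψ ⬝ᵥ ψ = 1)
    (hY : a * (L : ℝ) ^ 4 ≤
      (star ψ ⬝ᵥ (((pairField dWaveFormFactor L)ᴴ * pairField dWaveFormFactor L) *ᵥ ψ)).re) :
    (hubbardTorus 2 L 1 0).minEnergyOn (szSector (Λ := FermionTorus 2 L) (2 * n) 0) +
        a * Real.sqrt a / 32768 * (L : ℝ) ^ 2 ≤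
      (star ψ ⬝ᵥ (hubbardTorus 2 L 1 0 *ᵥ ψ)).re := by
  classical
  obtain ⟨F, eF, hFc, hF, hF', hdev⟩ := exists_fermiSet_deviation_le_energy_excess hL hψ h1
  -- occupations and deviations
  obtain ⟨x, hx⟩ : ∃ x : TorusSite 2 L → ℝ, ∀ k, (star ψ ⬝ᵥ (momentumNumber k 0 *ᵥ ψ)).re = x k :=
    ⟨_, fun _ => rfl⟩
  simp only [hx] at hdev
  have hx0 : ∀ k, 0 ≤ x k := fun k => by rw [← hx]; exact (re_expect_momentumNumber_mem_Icc k 0 ψ).1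
  have hx1 : ∀ k, x k ≤ 1 := fun k => by
    have := (re_expect_momentumNumber_mem_Icc k 0 ψ).2
    rwa [h1, Complex.one_re, hx] at this
  set dev : TorusSite 2 L → ℝ := fun k => if k ∈ F then 1 - x k else x k with hdev_def
  have hd0 : ∀ k, 0 ≤ dev k := fun k => by
    simp only [hdev_def]; split_ifs <;> linarith [hx0 k, hx1 k]
  have hd1 : ∀ k, dev k ≤ 1 := fun k => by
    simp only [hdev_def]; split_ifs <;> linarith [hx0 k, hx1 k]
  set K : ℝ := (star ψ ⬝ᵥ (hubbardTorus 2 L 1 0 *ᵥ ψ)).re -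
    (hubbardTorus 2 L 1 0).minEnergyOn (szSector (Λ := FermionTorus 2 L) (2 * n) 0) with hK
  set ξ : TorusSite 2 L → ℝ := fun k => |torusBand L k - eF| with hξ
  have hξ0 : ∀ k, 0 ≤ ξ k := fun k => abs_nonneg _
  have hdevK : ∑ k, ξ k * dev k ≤ K := hdev
  have hK0 : 0 ≤ K := le_trans (Finset.sum_nonneg fun k _ => mul_nonneg (hξ0 k) (hd0 k)) hdevK
  -- the pair amplitude scale `α = √(a/8)`
  set α : ℝ := Real.sqrt (a / 8) with hα
  have hα0 : 0 < α := Real.sqrt_pos.2 (by positivity)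
  have hα2 : α ^ 2 = a / 8 := Real.sq_sqrt (by positivity)
  have hL0' : (0 : ℝ) < L := by exact_mod_cast (show 0 < L by omega)
  -- Step 1: triangle bounds `α L² ≤ 2 Σ √dev + 2 √(Σ_F x)` and `√(Σ_F x) ≤ L`
  have hstep1 : α * (L : ℝ) ^ 2 ≤ 2 * ∑ k, Real.sqrt (dev k) + 2 * L := by
    have h := sqrt_le_deviation_of_le_re_expect_pairField_dWave F h1 hY
    simp only [hx] at h
    have hS : ∑ k ∈ Fᶜ, Real.sqrt (x k) + ∑ k ∈ F, Real.sqrt (1 - x k) = ∑ k, Real.sqrt (dev k) := by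
      rw [← Finset.sum_add_sum_compl F fun k => Real.sqrt (dev k), add_comm]
      congr 1
      · exact Finset.sum_congr rfl fun k hk => by
          rw [hdev_def]; dsimp only; rw [if_pos hk]
      · exact Finset.sum_congr rfl fun k hk => by
          rw [hdev_def]; dsimp only; rw [if_neg (Finset.mem_compl.1 hk)]
    have hFx : Real.sqrt (∑ k ∈ F, x k) ≤ L := by
      have hle : ∑ k ∈ F, x k ≤ (L : ℝ) ^ 2 := by
        calc ∑ k ∈ F, x k ≤ ∑ k ∈ F, (1 : ℝ) := Finset.sum_le_sum fun k _ => hx1 k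
          _ = F.card := by rw [Finset.sum_const, nsmul_eq_mul, mul_one]
          _ ≤ (L : ℝ) ^ 2 := by
              have := Finset.card_le_univ F
              rw [card_torusSite] at this
              exact_mod_cast this
      calc Real.sqrt (∑ k ∈ F, x k) ≤ Real.sqrt ((L : ℝ) ^ 2) := Real.sqrt_le_sqrt hle
        _ = L := Real.sqrt_sq hL0'.le
    rw [← hα] at h
    linarith
  -- Step 2: split the deviation sum at the window `|ξ| < e₀ = (α/4)²`
  set e₀ : ℝ := (α / 4) ^ 2 with he₀
  have he0 : 0 < e₀ := by positivity
  have hse : Real.sqrt e₀ = α / 4 := Real.sqrt_sq (by positivity)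
  have hwindow : ∑ k ∈ Finset.univ.filter (fun k => ¬ e₀ ≤ ξ k), Real.sqrt (dev k) ≤
      α / 4 * (L : ℝ) ^ 2 + 2 * L := by
    calc ∑ k ∈ Finset.univ.filter (fun k => ¬ e₀ ≤ ξ k), Real.sqrt (dev k)
        ≤ ∑ k ∈ Finset.univ.filter (fun k => ¬ e₀ ≤ ξ k), (1 : ℝ) :=
          Finset.sum_le_sum fun k _ => by
            rw [show (1 : ℝ) = Real.sqrt 1 from Real.sqrt_one.symm]
            exact Real.sqrt_le_sqrt (hd1 k)
      _ = ((Finset.univ.filter (fun k => ¬ e₀ ≤ ξ k)).card : ℝ) := by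
          rw [Finset.sum_const, nsmul_eq_mul, mul_one]
      _ ≤ ((Finset.univ.filter (fun k : TorusSite 2 L => |torusBand L k - eF| ≤ e₀)).card : ℝ) := by
          exact_mod_cast Finset.card_le_card fun k hk => by
            simp only [Finset.mem_filter, Finset.mem_univ, true_and, not_le, hξ] at hk ⊢
            exact hk.le
      _ ≤ Real.sqrt e₀ * (L : ℝ) ^ 2 + 2 * L := card_torusShell_le_sqrt eF e₀
      _ = α / 4 * (L : ℝ) ^ 2 + 2 * L := by rw [hse]
  have houtside : ∑ k ∈ Finset.univ.filter (fun k => e₀ ≤ ξ k), Real.sqrt (dev k) ≤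
      Real.sqrt K * Real.sqrt (16 * (L : ℝ) ^ 2 / α + 64 * L / α ^ 2) := by
    have hcs := Real.sum_sqrt_mul_sqrt_le (Finset.univ.filter (fun k => e₀ ≤ ξ k))
      (f := fun k => ξ k * dev k) (g := fun k => 1 / ξ k)
      (fun k => mul_nonneg (hξ0 k) (hd0 k)) (fun k => by positivity)
    have heq : ∀ k ∈ Finset.univ.filter (fun k => e₀ ≤ ξ k),
        Real.sqrt (dev k) = Real.sqrt (ξ k * dev k) * Real.sqrt (1 / ξ k) := by
      intro k hk
      have hk' : 0 < ξ k := lt_of_lt_of_le he0 (Finset.mem_filter.1 hk).2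
      rw [← Real.sqrt_mul (mul_nonneg (hξ0 k) (hd0 k)), mul_comm (ξ k), mul_assoc,
        mul_one_div_cancel hk'.ne', mul_one]
    rw [Finset.sum_congr rfl heq]
    refine hcs.trans (mul_le_mul ?_ ?_ (Real.sqrt_nonneg _) (Real.sqrt_nonneg _))
    · refine Real.sqrt_le_sqrt (le_trans ?_ hdevK)
      exact Finset.sum_le_sum_of_subset_of_nonneg (Finset.filter_subset _ _)
        fun k _ _ => mul_nonneg (hξ0 k) (hd0 k)
    · refine Real.sqrt_le_sqrt ((sum_inv_abs_sub_le (L := L) eF he0).trans (le_of_eq ?_))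
      rw [hse, he₀]
      field_simp
      ring
  have hsplit : ∑ k, Real.sqrt (dev k) =
      ∑ k ∈ Finset.univ.filter (fun k => e₀ ≤ ξ k), Real.sqrt (dev k) +
        ∑ k ∈ Finset.univ.filter (fun k => ¬ e₀ ≤ ξ k), Real.sqrt (dev k) :=
    (Finset.sum_filter_add_sum_filter_not _ _ _).symm
  -- Step 3: the threshold `α L ≥ 24`
  have hαL : 24 ≤ α * L := by
    have h2 : (24 : ℝ) ^ 2 ≤ (α * L) ^ 2 := by rw [mul_pow, hα2]; nlinarith
    exact le_of_pow_le_pow_left₀ two_ne_zero (by positivity) h2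
  -- Step 4: combine: `α L²/4 ≤ 2 √K √W`, square, and bound `W`
  set W : ℝ := 16 * (L : ℝ) ^ 2 / α + 64 * L / α ^ 2 with hW
  have hW0 : 0 ≤ W := by positivity
  have hmain : α / 4 * (L : ℝ) ^ 2 ≤ 2 * (Real.sqrt K * Real.sqrt W) := by
    have h6 : 6 * (L : ℝ) ≤ α / 4 * (L : ℝ) ^ 2 := by
      nlinarith [mul_nonneg (sub_nonneg.2 hαL) hL0'.le]
    rw [hsplit] at hstep1
    linarith
  have hsq : (α / 4 * (L : ℝ) ^ 2) ^ 2 ≤ 4 * (K * W) := by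
    have h := pow_le_pow_left₀ (by positivity) hmain 2
    have e : (2 * (Real.sqrt K * Real.sqrt W)) ^ 2 = 4 * (K * W) := by
      rw [mul_pow, mul_pow, Real.sq_sqrt hK0, Real.sq_sqrt hW0]
      norm_num
    rwa [e] at h
  have hWle : W ≤ 56 / 3 * (L : ℝ) ^ 2 / α := by
    rw [hW]
    have h64 : 64 * (L : ℝ) / α ^ 2 ≤ 8 / 3 * (L : ℝ) ^ 2 / α := by
      rw [div_le_div_iff₀ (by positivity) hα0]
      nlinarith [mul_nonneg (sub_nonneg.2 hαL) (mul_pos hα0 hL0').le]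
    have : 16 * (L : ℝ) ^ 2 / α + 8 / 3 * (L : ℝ) ^ 2 / α = 56 / 3 * (L : ℝ) ^ 2 / α := by ring
    linarith
  -- `α³ L² ≤ (3584/3) K`
  have hcube : α ^ 3 * (L : ℝ) ^ 2 ≤ 3584 / 3 * K := by
    have h1' : α ^ 2 / 16 * (L : ℝ) ^ 4 ≤ 4 * (K * (56 / 3 * (L : ℝ) ^ 2 / α)) := by
      have : (α / 4 * (L : ℝ) ^ 2) ^ 2 = α ^ 2 / 16 * (L : ℝ) ^ 4 := by ring
      rw [← this]
      exact hsq.trans (mul_le_mul_of_nonneg_left (mul_le_mul_of_nonneg_left hWle hK0) (by norm_num))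
    have h2' : 4 * (K * (56 / 3 * (L : ℝ) ^ 2 / α)) = (224 / 3 * K * (L : ℝ) ^ 2) / α := by ring
    rw [h2', le_div_iff₀ hα0] at h1'
    have hL2 : (0 : ℝ) < (L : ℝ) ^ 2 := by positivity
    have h3 : α ^ 3 * (L : ℝ) ^ 2 * (L : ℝ) ^ 2 ≤ 3584 / 3 * K * (L : ℝ) ^ 2 := by nlinarith [h1']
    exact le_of_mul_le_mul_right h3 hL2
  -- `a √a = 8 √8 α³` and `√8 ≤ 24/7`
  have hsqrt_a : Real.sqrt a = Real.sqrt 8 * α := by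
    rw [hα, ← Real.sqrt_mul (by norm_num : (0 : ℝ) ≤ 8)]
    congr 1
    ring
  have ha8 : a = 8 * α ^ 2 := by rw [hα2]; ring
  have hs8 : Real.sqrt 8 ≤ 24 / 7 := by
    rw [show (24 / 7 : ℝ) = Real.sqrt ((24 / 7) ^ 2) from (Real.sqrt_sq (by norm_num)).symm]
    exact Real.sqrt_le_sqrt (by norm_num)
  have hs80 : 0 ≤ Real.sqrt 8 := Real.sqrt_nonneg _
  have hfin : a * Real.sqrt a / 32768 * (L : ℝ) ^ 2 ≤ K := by
    rw [hsqrt_a, ha8]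
    have hα3 : 0 ≤ α ^ 3 * (L : ℝ) ^ 2 := by positivity
    calc 8 * α ^ 2 * (Real.sqrt 8 * α) / 32768 * (L : ℝ) ^ 2
        = Real.sqrt 8 / 4096 * (α ^ 3 * (L : ℝ) ^ 2) := by ring
      _ ≤ (24 / 7) / 4096 * (α ^ 3 * (L : ℝ) ^ 2) := by
          exact mul_le_mul_of_nonneg_right (by linarith) hα3
      _ ≤ (24 / 7) / 4096 * (3584 / 3 * K) := mul_le_mul_of_nonneg_left hcube (by norm_num)
      _ = K := by ring
  rw [hK] at hfin
  linarith

/-- **`d`-wave pair LRO costs kinetic energy — rate `a^{3/2}` at given side.** For `a > 0`, every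
side `L ≥ ⌈1536/a⌉ + 3`, every `N` and every unit `ψ ∈ szSector N 0` with `Re ⟨ψ, Δ_d†Δ_d ψ⟩ ≥ a·L⁴`:
`minEnergyOn H₀ (szSector N 0) + (a√a/32768)·L² ≤ Re ⟨ψ, H₀ ψ⟩` (`N` is even, or the sector is
trivial). Same shape as `freeDWavePairing_costs_energy_sharp_rate`.
Bardeen–Cooper–Schrieffer (1957) §II. [folklore] -/
theorem freeDWavePairing_costs_energy_opt_rate {a : ℝ} (ha : 0 < a) {L : ℕ} [NeZero L]
    (hL : ⌈1536 / a⌉₊ + 3 ≤ L) {N : ℕ} {ψ : Fock (Orb (FermionTorus 2 L))}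
    (hψ : ψ ∈ szSector (Λ := FermionTorus 2 L) N 0) (h1 : star ψ ⬝ᵥ ψ = 1)
    (hY : a * (L : ℝ) ^ 4 ≤
      (star ψ ⬝ᵥ (((pairField dWaveFormFactor L)ᴴ * pairField dWaveFormFactor L) *ᵥ ψ)).re) :
    (hubbardTorus 2 L 1 0).minEnergyOn (szSector (Λ := FermionTorus 2 L) N 0) +
        a * Real.sqrt a / 32768 * (L : ℝ) ^ 2 ≤
      (star ψ ⬝ᵥ (hubbardTorus 2 L 1 0 *ᵥ ψ)).re := by
  have hL3 : 3 ≤ L := by omega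
  have hLa : 4608 ≤ a * (L : ℝ) ^ 2 := by
    have hceil : 1536 / a ≤ (⌈1536 / a⌉₊ : ℝ) := Nat.le_ceil _
    have hL' : (⌈1536 / a⌉₊ : ℝ) + 3 ≤ (L : ℝ) := by exact_mod_cast hL
    have hlt : 1536 / a < (L : ℝ) := by linarith
    rw [div_lt_iff₀' ha] at hlt
    have hL3' : (3 : ℝ) ≤ L := by exact_mod_cast hL3
    nlinarith
  have h0 : ψ ≠ 0 := by rintro rfl; simp at h1
  obtain ⟨n, rfl⟩ := exists_eq_two_mul_of_mem_szSector_zero hψ h0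
  exact freeDWavePairing_costs_energy_opt_explicit ha hL3 hLa hψ h1 hY

/-- **A-priori form: small kinetic excess carries little `d`-wave pair order.** For `a > 0`,
`L ≥ 3` with `a·L² ≥ 4608`, and a unit `ψ ∈ szSector (2n) 0` whose free kinetic energy is less than
`(a√a/32768)·L²` above the free sector ground energy: `Re ⟨ψ, Δ_d†Δ_d ψ⟩ < a·L⁴`. Equivalently an
excess density `e = X/L²` allows a `d`-wave pair density below `(32768 e)^{2/3} = 1024 e^{2/3}`
(beyond the finite-size threshold). Bardeen–Cooper–Schrieffer (1957) §II. [folklore] -/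
theorem re_expect_pairField_dWave_lt_of_energy_excess_lt_opt {a : ℝ} (ha : 0 < a) (hL : 3 ≤ L)
    (hLa : 4608 ≤ a * (L : ℝ) ^ 2) {n : ℕ} {ψ : Fock (Orb (FermionTorus 2 L))}
    (hψ : ψ ∈ szSector (Λ := FermionTorus 2 L) (2 * n) 0) (h1 : star ψ ⬝ᵥ ψ = 1)
    (hX : (star ψ ⬝ᵥ (hubbardTorus 2 L 1 0 *ᵥ ψ)).re <
      (hubbardTorus 2 L 1 0).minEnergyOn (szSector (Λ := FermionTorus 2 L) (2 * n) 0) +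
        a * Real.sqrt a / 32768 * (L : ℝ) ^ 2) :
    (star ψ ⬝ᵥ (((pairField dWaveFormFactor L)ᴴ * pairField dWaveFormFactor L) *ᵥ ψ)).re <
      a * (L : ℝ) ^ 4 := by
  by_contra h
  push Not at h
  have := freeDWavePairing_costs_energy_opt_explicit ha hL hLa hψ h1 h
  linarith

end Assembly

end Literature.MathematicalPhysics.QuantumLattice
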